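import Summits.HodgeConjecture.HodgeConjecture.Theorems.R90S6TreeFixDataTypeTwoU2            -- ★ HF2 FILE 1 (this seat): `ncard_fixed_selfDual_eq_ncard_selfDualStable`, `ncard_fixed_selfDual_eq_sum_of_typeTwoCorner`; brings ★ `exists_rescaled_cyclicFrame`, ★ `ncard_selfDualStable_congr`, ★ `ncard_selfDualStable_antidiag_companion_eq_sum`, ★ `isUnimodular₂_iff_exists_mem_glInt`
import Summits.HodgeConjecture.HodgeConjecture.Theorems.R90S6ShellSphereDictU2                -- ★ A1-H FILE 1 (p01): `typeFun_ne_of_adj_two`, `valuation_map_eq_of_datum`, `isUnimodular₂_antidiagonal_two`; brings ★ `isTree_latticeTree`, ★ `not_isModularLattice_of_isSelfDualLattice`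
import Summits.HodgeConjecture.HodgeConjecture.Theorems.R90S6TreeFixDataFirstShell              -- ★ GF1 FILE 1 (K2Liu-p14): `ncard_displaced_two_inter_type_add_card_fixed_eq` (THE bipartite bookkeeping, dealer DEDUP RULING A); brings ★ W8-f
import HarnessLib

/-!
# R90 · S6 — row E1.3.5.2.6, CARD HF2 FILE 2: THE FIRST SHELLS OF THE TYPE-(2) CORNER ON `X₂` — `N₀(t_H) = N₁(t_H) = q^{N+1}`
# (`Theorems/R90S6TreeFixDataTypeTwoU2Shells.lean`)

Cell `hodgecm-mathlib`, crux H413 (`stmt-HodgeConjecture-24833`), route of record `HCCMUnconditional`; programme R90-TF, section S6 (base `R90-C14`), seat R90-C14-p07 (g2);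
S6 dealer R90-C14-plan (g2) CARD HF2 (02:06:19Z), census «=» AS CUT (02:14:19Z), FILE 2 census «=» route (b) (02:21:21Z): the first shells `N₀, N₁` of ★ H2-NUMBERS
(`R90S6HSideEllipticValueClosed` :119 set-builders VERBATIM, type function `(c) (hc0)`, local finiteness `hloc`, valency `hdeg`) for the type-(2) corner `t_H = (A Cρ; C A)`
by BIPARTITE BOOKKEEPING over the fixed subtree.  Helper lane `--supports stmt-HodgeConjecture-24833 --as helper`; THEOREMS ONLY (no definition, no instance, no notation, no
named fact, no `sorry`); imports = ★ HF2 FILE 1 + ★ A1-H FILE 1 + ★ GF1 FILE 1 + HarnessLib.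

THE MATHEMATICS [Kottwitz1988, §2; Serre1980Trees, I.2.3, I.6.1, I.6.4 Prop. 24; Flicker1998UnitaryFL, §6 p. 97].  `X₂ = latticeTree σ ϖ J₂` (`(q+1)`-regular, two vertex
types: self-dual `0` ∕ `ϖ`-modular `1`, edges join different types), `γ ∈ U₂` with finite non-empty fixed set `F = F₀ ⊔ F₁`.  (§1) the fixed `ϖ`-MODULAR vertices of `γ`
are the `γ`-stable self-dual lattices of the RESCALED form `ϖ⁻¹J₂` (★ `isUnimodular₂_iff_exists_mem_glInt`), so for the type-(2) corner the same engine as FILE 1 (isotropic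
cyclic frame rescaled by `ϖ^{−r′}`, `N − 1 = 2r′ + e′`, `r′ ∈ ℤ`; ★ `ncard_selfDualStable_congr`; ★ `ncard_selfDualStable_antidiag_companion_eq_sum`, whose `N` is read off
`|tr² − 4 det|` and does not see the form) gives **`V₁ := #F₁ = Σ_{k≤N} q^k = V₀`**.  (§2, HEAD) BOOKKEEPING is ★ GF1 FILE 1 (K2Liu-p14)
`ncard_displaced_two_inter_type_add_card_fixed_eq` — on a locally finite tree with an automorphism of finite fixed set `F` and a proper `2`-colouring, `N_i + #F = d_j·#F_j + 1`
(the moved neighbours of the colour-`j` fixed vertices are the colour-`i` first shell, ★ W8-f; the fixed ones are the fixed edges, `#F − 1` of them); for `t_H`: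
`#F₀ = #F₁ = P := Σ_{k≤N} q^k` (FILE 1 + §1), `#F = 2P`, valency `d ≡ q + 1`,
so `N_i = (q+1)P − 2P + 1 = (q − 1)P + 1 = q^{N+1}` (Mathlib `geom_sum_mul_add`) — **`N₀(t_H) = N₁(t_H) = q^{N+1}`**: the `q` outward neighbours of each of the `2q^N` boundary
vertices of the edge-centred ball of radius `N`, the two sides of opposite type.  Hand check `N = 0`: `F = {L₀, ΠL₀}`, `N₀ = N₁ = q`.
HONEST LABEL: the H-side DATA `(N₀, N₁)` of one type-(2) class, unconditional in its letters (valency and local finiteness as binders, as in ★ H2-NUMBERS); count-neutral until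
typ1's (E2) consumes it.  HC_CM is proved only modulo the 7 printed citations (2 remaining named inputs: hLiu418 = stmt-HodgeConjecture-24832, h413 = stmt-HodgeConjecture-24833)
until rung 0 closes.

## References
* [Kottwitz1988] R. E. Kottwitz, *Tamagawa numbers*, Ann. of Math. 127 (1988), §2 (fixed subtrees, Euler characteristic).
* [Serre1980Trees] J.-P. Serre, *Trees* (1980), Ch. I §2.3, §6.1, §6.4 Prop. 24; Ch. II §1.1.
* [Flicker1998UnitaryFL] Y. Z. Flicker, *Elementary proof of the fundamental lemma for a unitary group*, Canad. J. Math. 50 (1998), §6 p. 97.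
* [LabesseLanglands1979] J.-P. Labesse, R. P. Langlands, *L-indistinguishability for SL(2)*, Canad. J. Math. 31 (1979), §2 p. 8.
-/
set_option autoImplicit false
-- the mandated namespace repeats the single-problem summit's segment (`HodgeConjecture.HodgeConjecture`)
set_option linter.dupNamespace false

noncomputable section

open Matrix Finset ValuativeRel SimpleGraph
open Literature.NumberTheory.Automorphic Literature.NumberTheory.Automorphic.UnitaryGroup Literature.NumberTheory.Automorphic.HermitianLatticeTree
open Literature.Combinatorics.SimpleGraph
open scoped Matrix MatrixGroups WithZero ValuativeRel

namespace Summit.HodgeConjecture.HodgeConjecture.R90.S6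

/-! ### §1 The fixed `ϖ`-modular vertices of the type-(2) corner: `V₁ = Σ_{k ≤ N} q^k` -/

section Modular

variable {K : Type*} [Field K] [Valued K ℤᵐ⁰] [ValuativeRel K] [(Valued.v : Valuation K ℤᵐ⁰).Compatible] {σ : K →+* K} {ϖ : K}

omit [Valued K ℤᵐ⁰] [(Valued.v : Valuation K ℤᵐ⁰).Compatible] in
/-- **MODULAR VERTICES ↔ STABLE SELF-DUAL LATTICES OF THE RESCALED FORM**: for `γ ∈ U(σ, H)` the `γ`-fixed `ϖ`-MODULAR vertices of `X₂ = latticeTree σ ϖ H` are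
equinumerous with the `γ`-stable self-dual lattices of `ϖ⁻¹·H` (`ϖ⁻¹·ᵗ(σg)Hg = ᵗ(σg)(ϖ⁻¹H)g`; ★ `isUnimodular₂_iff_exists_mem_glInt`, ★ `latticeTreeIso_apply_eq_self_iff`).
[cite: Serre1980Trees, II.1.1] [cite: Kottwitz1988, §2] -/
theorem ncard_fixed_modular_eq_ncard_selfDualStable_inv_smul (H : Matrix (Fin 2) (Fin 2) K) (γ : ↥(unitaryGroupOfForm σ H)) :
    {x : {M : Submodule 𝒪[K] (Fin 2 → K) // IsSpecialLattice σ ϖ H M} | IsModularLattice σ ϖ H x.1 ∧ latticeTreeIso σ ϖ H γ x = x}.ncard =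
      {Λ : Submodule 𝒪[K] (Fin 2 → K) |
        (∃ g : GL (Fin 2) K, (∃ J' ∈ glInt 2 K, (J' : Matrix (Fin 2) (Fin 2) K) = formCongr σ g (ϖ⁻¹ • H)) ∧ Λ = Submodule.span 𝒪[K] (Set.range ((g : Matrix (Fin 2) (Fin 2) K))ᵀ)) ∧
        Λ.map ((Matrix.toLin' (((γ : ↥(unitaryGroupOfForm σ H)) : GL (Fin 2) K) : Matrix (Fin 2) (Fin 2) K)).restrictScalars 𝒪[K]) = Λ}.ncard := by
  classical
  have hsm : ∀ g : GL (Fin 2) K, formCongr σ g (ϖ⁻¹ • H) = ϖ⁻¹ • formCongr σ g H := fun g => by simp only [formCongr, Matrix.mul_smul, Matrix.smul_mul]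
  refine Set.ncard_congr (fun x _ => x.1) (fun x hx => ?_) (fun x y _ _ h => Subtype.ext h) (fun Λ hΛ => ?_)
  · obtain ⟨hmd, hfix⟩ := hx
    obtain ⟨g, hM, hU⟩ := hmd
    rw [latticeTreeIso_apply_eq_self_iff] at hfix
    exact ⟨⟨g, by rw [hsm]; exact (isUnimodular₂_iff_exists_mem_glInt _).1 hU, hM⟩, hfix⟩
  · obtain ⟨⟨g, hJ', hΛ⟩, hmap⟩ := hΛ
    rw [hsm] at hJ'
    have hmd : IsModularLattice σ ϖ H Λ := ⟨g, hΛ, (isUnimodular₂_iff_exists_mem_glInt _).2 hJ'⟩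
    refine ⟨⟨Λ, Or.inr hmd⟩, ⟨hmd, ?_⟩, rfl⟩
    rw [latticeTreeIso_apply_eq_self_iff]
    exact hmap

/-- **THE FIXED `ϖ`-MODULAR VERTICES OF THE TYPE-(2) CORNER: `V₁(t_H) = Σ_{k ≤ N} q^k`** (letters of ★ FILE 1 `ncard_fixed_selfDual_eq_sum_of_typeTwoCorner`): the same count as the
self-dual one — the isotropic cyclic frame rescaled by `a = ϖ^{−r′}`, `N = 2r′ + e′ + 1` (`r′ ∈ ℤ`), turns the rescaled form `ϖ⁻¹J₂` into `antidiag(β, σβ)` with `|β| = |ϖ^{e′}|`, and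
★ `ncard_selfDualStable_antidiag_companion_eq_sum` reads `N` off `|tr² − 4 det| = |ϖ^{2N+1}|`. [cite: Flicker1998UnitaryFL, §6 p. 97] [cite: Kottwitz1988, §2] -/
theorem ncard_fixed_modular_eq_sum_of_typeTwoCorner (hd : HermitianLattice.LocalConjDatum σ ϖ)
    (σO : 𝒪[K] →+* 𝒪[K]) (hσO' : ∀ x : 𝒪[K], ((σO x : 𝒪[K]) : K) = σ x)
    {a₀ : 𝒪[K]} (ha₀ : IsUnit (σO a₀ - a₀)) [Finite (IsLocalRing.ResidueField 𝒪[K])] {q : ℕ} (hq : Nat.card (IsLocalRing.ResidueField 𝒪[K]) = q ^ 2)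
    {tH : ↥(unitaryGroupOfForm σ ((StdForm.antidiagonal 2).over K))} {A C ρ : K}
    (htH : ((tH : GL (Fin 2) K) : Matrix (Fin 2) (Fin 2) K) = !![A, C * ρ; C, A])
    (hvρ : Valued.v ρ = Valued.v ϖ) {N : ℕ} (hvC : Valued.v C = Valued.v (ϖ ^ N)) :
    {x : {M : Submodule 𝒪[K] (Fin 2 → K) // IsSpecialLattice σ ϖ ((StdForm.antidiagonal 2).over K) M} |
        IsModularLattice σ ϖ ((StdForm.antidiagonal 2).over K) x.1 ∧ latticeTreeIso σ ϖ ((StdForm.antidiagonal 2).over K) tH x = x}.ncard =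
      ∑ k ∈ range (N + 1), q ^ k := by
  classical
  have hϖv := hd.vϖ
  have hϖ : IsUniformizingElement ϖ := isUniformizingElement_of_v_eq hϖv
  have h0 : ϖ ≠ 0 := hd.ϖ_ne_zero
  haveI : IsDiscreteValuationRing 𝒪[K] := isDiscreteValuationRing_integer_of_compatible hϖv
  have hvpow : ∀ j : ℕ, Valued.v (ϖ ^ j) = WithZero.exp (-(j : ℤ)) := fun j => by
    rw [map_pow, hϖv, ← WithZero.exp_nsmul, nsmul_eq_mul, mul_neg, mul_one]
  have hv4 : Valued.v (4 : K) = 1 := by rw [show (4 : K) = 2 * 2 by norm_num, map_mul, hd.v2, one_mul]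
  have hσv : ∀ x, valuation K (σ x) = valuation K x := fun x => (v_eq_iff_valuation_eq _ _).1 (hd.vσ x)
  have h2 : valuation K 2 = 1 := (v_eq_one_iff_valuation_eq_one _).1 hd.v2
  have hσσ : ∀ x, σO (σO x) = x := fun x => Subtype.ext (by rw [hσO', hσO', hd.σσ])
  have hJ₂ : (StdForm.antidiagonal 2).over K = !![(0 : K), 1; 1, 0] := by
    ext i j; fin_cases i <;> fin_cases j <;> simp [StdForm.over, StdForm.antidiagonal_J_apply]
  -- the corner, its unitarity, trace, determinant
  set tGL : GL (Fin 2) K := (tH : GL (Fin 2) K) with htGL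
  set g : Matrix (Fin 2) (Fin 2) K := !![A, C * ρ; C, A] with hg
  have hgU : (g.map σ)ᵀ * (!![0, 1; 1, 0] : Matrix (Fin 2) (Fin 2) K) * g = !![0, 1; 1, 0] := by
    have h := mem_unitaryGroupOfForm_iff.1 tH.2
    rw [← htGL, htH] at h
    rwa [hJ₂] at h
  have htr_g : g.trace = 2 * A := by rw [hg, Matrix.trace_fin_two_of]; ring
  have hdet_g : g.det = A ^ 2 - C ^ 2 * ρ := by rw [hg, Matrix.det_fin_two_of]; ring
  have hg10 : g 1 0 = C := by simp [hg]
  have hC0 : C ≠ 0 := fun h => by rw [h, map_zero, hvpow] at hvC; exact WithZero.zero_ne_coe hvC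
  have hg10' : g 1 0 ≠ 0 := by rw [hg10]; exact hC0
  -- the exponents: `N = 2r′ + e′ + 1`, `r′ ∈ ℤ`, rescaling `a = ϖ^{−r′}`
  obtain ⟨r, e, he, hNe⟩ : ∃ (r : ℤ) (e : ℕ), e ≤ 1 ∧ (N : ℤ) = 2 * r + e + 1 :=
    ⟨((N : ℤ) - 1) / 2, (((N : ℤ) - 1) % 2).toNat, by omega, by omega⟩
  set a : K := ϖ ^ (-r) with ha
  have ha0 : a ≠ 0 := zpow_ne_zero _ h0
  have hσa : σ a = a := by rw [ha, map_zpow₀, hd.σϖ]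
  -- ★ the rescaled isotropic cyclic frame
  obtain ⟨P', hC', hform', hdβ, htr⟩ := exists_rescaled_cyclicFrame σ tGL g htH hgU hg10' ha0 hσa
  have hdv : valuation K g.det = 1 := by
    have h := congrArg (valuation K) hdβ
    rw [map_mul, Valuation.map_neg, hσv] at h
    exact mul_right_cancel₀ ((Valuation.ne_zero_iff _).2 hg10') (h.trans (one_mul _).symm)
  have hvdet : Valued.v (A ^ 2 - C ^ 2 * ρ) = 1 := by rw [← hdet_g]; exact (v_eq_one_iff_valuation_eq_one _).2 hdv
  have hCρ : Valued.v (C ^ 2 * ρ) = Valued.v (ϖ ^ (2 * N + 1)) := by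
    rw [map_mul, map_pow, hvC, hvρ, hvpow, hϖv, hvpow, ← WithZero.exp_nsmul, ← WithZero.exp_add]; congr 1; push_cast; ring
  have hvA : Valued.v A ≤ 1 := by
    have h1 : Valued.v (A ^ 2) ≤ max (Valued.v (A ^ 2 - C ^ 2 * ρ)) (Valued.v (C ^ 2 * ρ)) := by
      have e1 : A ^ 2 = (A ^ 2 - C ^ 2 * ρ) + C ^ 2 * ρ := by ring
      rw [e1]; exact Valuation.map_add _ _ _ |>.trans (by rw [← e1])
    rw [map_pow, hvdet, hCρ, hvpow] at h1
    have h2' : Valued.v A ^ 2 ≤ 1 := h1.trans (max_le le_rfl (by rw [← WithZero.exp_zero, WithZero.exp_le_exp]; omega))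
    exact (pow_le_one_iff two_ne_zero).1 h2'
  have ht : g.trace ∈ 𝒪[K] := (v_le_one_iff_mem_integer _).1 (by rw [htr_g, map_mul, hd.v2, one_mul]; exact hvA)
  have hD : valuation K (g.trace ^ 2 - 4 * g.det) = valuation K (ϖ ^ (2 * N + 1)) := by
    refine (v_eq_iff_valuation_eq _ _).1 ?_
    rw [htr_g, hdet_g, show (2 * A) ^ 2 - 4 * (A ^ 2 - C ^ 2 * ρ) = 4 * (C ^ 2 * ρ) by ring, map_mul, hv4, one_mul, hCρ]
  -- the rescaled form: `β = ϖ⁻¹ a² g₁₀`, `|β| = |ϖ^{e′}|`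
  have hβ' : valuation K (ϖ⁻¹ * (a ^ 2 * g 1 0)) = valuation K (ϖ ^ e) := by
    refine (v_eq_iff_valuation_eq _ _).1 ?_
    rw [hg10, map_mul, map_inv₀, map_mul, map_pow, ha, map_zpow₀, hvC, map_pow, map_pow, hϖv]
    simp only [← WithZero.exp_nsmul, ← WithZero.exp_zsmul, ← WithZero.exp_neg, ← WithZero.exp_add, nsmul_eq_mul, zsmul_eq_mul]
    congr 1; push_cast; omega
  have htr' : ϖ⁻¹ * (a ^ 2 * g 1 0) * σ g.trace + σ (ϖ⁻¹ * (a ^ 2 * g 1 0)) * g.trace = 0 := by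
    rw [map_mul, map_mul, map_pow, hσa, map_inv₀, hd.σϖ]; linear_combination ϖ⁻¹ * a ^ 2 * htr
  have hform : formCongr σ P' (ϖ⁻¹ • (StdForm.antidiagonal 2).over K) = !![0, ϖ⁻¹ * (a ^ 2 * g 1 0); σ (ϖ⁻¹ * (a ^ 2 * g 1 0)), 0] := by
    have hsm : formCongr σ P' (ϖ⁻¹ • (StdForm.antidiagonal 2).over K) = ϖ⁻¹ • formCongr σ P' ((StdForm.antidiagonal 2).over K) := by
      simp only [formCongr, Matrix.mul_smul, Matrix.smul_mul]
    rw [hsm, hJ₂, hform']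
    ext i j; fin_cases i <;> fin_cases j <;> simp [hd.σϖ]
  -- §1 bridge, ★ frame transport, ★ the type-(2) H-side lattice count
  rw [ncard_fixed_modular_eq_ncard_selfDualStable_inv_smul, ← htGL, ncard_selfDualStable_congr σ (ϖ⁻¹ • (StdForm.antidiagonal 2).over K) tGL P', hform]
  exact ncard_selfDualStable_antidiag_companion_eq_sum hϖ σ σO hσO' hσσ hd.σϖ hσv h2 ht hdv he hβ' hD htr' _ hC' ha₀ hq

end Modular

/-! ### §2 (HF2.3) The first shells of the type-(2) corner: `N₀ = N₁ = q^{N+1}` -/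

section Shells

variable {K : Type} [Field K] [Valued K ℤᵐ⁰] [ValuativeRel K] [(Valued.v : Valuation K ℤᵐ⁰).Compatible] {σ : K →+* K} {ϖ : K}

/-- **(HF2.3) THE FIRST SHELLS OF THE TYPE-(2) CORNER: `N_i(t_H) = q^{N+1}` for both types `i`.**  `K` non-dyadic (`hd : LocalConjDatum σ ϖ`), residual frame `(σO, a₀, #𝓀 = q²)` of ★
`ncard_selfDualStable_antidiag_companion_eq_sum`; `X₂ = latticeTree σ ϖ J₂` locally finite (`hloc`) of valency `q + 1` (`hdeg`), type function `c` (`hc0`) — ★ H2-NUMBERS' binders and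
its first-shell set-builder `{x | dist x (t_H x) = 2 ∧ c x = i}` VERBATIM; `t_H ∈ U₂`, `↑t_H = (A Cρ; C A)`, `|ρ| = |ϖ|`, `|C| = |ϖ^N|`.  Then `N_i = q^{N+1}`: `V₀ = V₁ = P = Σ_{k≤N} q^k`
(★ FILE 1 + §1), `#Fix = 2P`, `N_i + 2P = (q+1)·P + 1` (★ GF1 FILE 1 `ncard_displaced_two_inter_type_add_card_fixed_eq` at `d ≡ q + 1`), `(q − 1)·P + 1 = q^{N+1}` (Mathlib
`geom_sum_mul_add`).
[cite: Kottwitz1988, §2] [cite: Serre1980Trees, I.6.4 Prop. 24] [cite: Flicker1998UnitaryFL, §6 p. 97] [cite: LabesseLanglands1979, §2 p. 8] -/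
theorem ncard_firstShell_eq_pow_of_typeTwoCorner (hd : HermitianLattice.LocalConjDatum σ ϖ)
    (σO : 𝒪[K] →+* 𝒪[K]) (hσO' : ∀ x : 𝒪[K], ((σO x : 𝒪[K]) : K) = σ x)
    {a₀ : 𝒪[K]} (ha₀ : IsUnit (σO a₀ - a₀)) [Finite (IsLocalRing.ResidueField 𝒪[K])] {q : ℕ} (hq : Nat.card (IsLocalRing.ResidueField 𝒪[K]) = q ^ 2)
    (hloc : ∀ v, ((latticeTree σ ϖ ((StdForm.antidiagonal 2).over K)).neighborSet v).Finite)
    (hdeg : ∀ v, ((latticeTree σ ϖ ((StdForm.antidiagonal 2).over K)).neighborSet v).ncard = q + 1)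
    (c : {M : Submodule 𝒪[K] (Fin 2 → K) // IsSpecialLattice σ ϖ ((StdForm.antidiagonal 2).over K) M} → Fin 2)
    (hc0 : ∀ v, c v = 0 ↔ IsSelfDualLattice σ ((StdForm.antidiagonal 2).over K) v.1)
    {tH : ↥(unitaryGroupOfForm σ ((StdForm.antidiagonal 2).over K))} {A C ρ : K}
    (htH : ((tH : GL (Fin 2) K) : Matrix (Fin 2) (Fin 2) K) = !![A, C * ρ; C, A])
    (hvρ : Valued.v ρ = Valued.v ϖ) {N : ℕ} (hvC : Valued.v C = Valued.v (ϖ ^ N)) (i : Fin 2) :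
    {x : {M : Submodule 𝒪[K] (Fin 2 → K) // IsSpecialLattice σ ϖ ((StdForm.antidiagonal 2).over K) M} |
        (latticeTree σ ϖ ((StdForm.antidiagonal 2).over K)).dist x (latticeTreeIso σ ϖ ((StdForm.antidiagonal 2).over K) tH x) = 2 ∧ c x = i}.ncard =
      q ^ (N + 1) := by
  classical
  haveI := isDiscreteValuationRing_integer_of_compatible hd.vϖ
  have hσv := valuation_map_eq_of_datum hd.toUnramified
  have hϖ := isUniformizingElement_of_v_eq hd.vϖ
  have hT := isTree_latticeTree σ hσv hϖ (isUnimodular₂_antidiagonal_two (K := K))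
  haveI : (latticeTree σ ϖ ((StdForm.antidiagonal 2).over K)).LocallyFinite := fun v => (hloc v).fintype
  have hcadj := typeFun_ne_of_adj_two hd.toUnramified c hc0
  -- the two fixed halves `F₀`, `F₁` and their counts `P`
  have hV₀ := ncard_fixed_selfDual_eq_sum_of_typeTwoCorner hd σO hσO' ha₀ hq htH hvρ hvC
  have hV₁ := ncard_fixed_modular_eq_sum_of_typeTwoCorner hd σO hσO' ha₀ hq htH hvρ hvC
  obtain ⟨P, hP⟩ : ∃ P : ℕ, ∑ k ∈ range (N + 1), q ^ k = P := ⟨_, rfl⟩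
  have hP1 : 1 ≤ P := by
    rw [← hP, Finset.sum_range_succ', pow_zero]; exact le_add_self
  rw [hP] at hV₀ hV₁
  -- `F₀ = {fixed, c = 0}`, `F₁ = {fixed, c = 1}`, `F = F₀ ⊔ F₁`
  have hdisj : ∀ v : {M : Submodule 𝒪[K] (Fin 2 → K) // IsSpecialLattice σ ϖ ((StdForm.antidiagonal 2).over K) M},
      IsSelfDualLattice σ ((StdForm.antidiagonal 2).over K) v.1 → ¬ IsModularLattice σ ϖ ((StdForm.antidiagonal 2).over K) v.1 :=
    fun v h1 h2 => not_isModularLattice_of_isSelfDualLattice σ hσv hϖ _ h1 h2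
  have hc1 : ∀ v : {M : Submodule 𝒪[K] (Fin 2 → K) // IsSpecialLattice σ ϖ ((StdForm.antidiagonal 2).over K) M},
      c v = 1 ↔ IsModularLattice σ ϖ ((StdForm.antidiagonal 2).over K) v.1 := by
    intro v
    constructor
    · intro h
      rcases v.2 with hsd | hmd
      · exact absurd ((hc0 v).2 hsd) (by rw [h]; decide)
      · exact hmd
    · intro hmd
      have h0 : c v ≠ 0 := fun h0 => hdisj v ((hc0 v).1 h0) hmd
      revert h0; generalize c v = x; revert x; decide
  have hF0 : {v : {M : Submodule 𝒪[K] (Fin 2 → K) // IsSpecialLattice σ ϖ ((StdForm.antidiagonal 2).over K) M} |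
      latticeTreeIso σ ϖ ((StdForm.antidiagonal 2).over K) tH v = v ∧ c v = 0}.ncard = P := by
    rw [← hV₀]; congr 1; ext v; simp only [Set.mem_setOf_eq, hc0]; exact and_comm
  have hF1 : {v : {M : Submodule 𝒪[K] (Fin 2 → K) // IsSpecialLattice σ ϖ ((StdForm.antidiagonal 2).over K) M} |
      latticeTreeIso σ ϖ ((StdForm.antidiagonal 2).over K) tH v = v ∧ c v = 1}.ncard = P := by
    rw [← hV₁]; congr 1; ext v; simp only [Set.mem_setOf_eq, hc1]; exact and_comm
  -- finiteness of the fixed set (both halves have positive count) and a fixed vertex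
  have hfin0 : {v : {M : Submodule 𝒪[K] (Fin 2 → K) // IsSpecialLattice σ ϖ ((StdForm.antidiagonal 2).over K) M} |
      latticeTreeIso σ ϖ ((StdForm.antidiagonal 2).over K) tH v = v ∧ c v = 0}.Finite := Set.finite_of_ncard_ne_zero (by rw [hF0]; omega)
  have hfin1 : {v : {M : Submodule 𝒪[K] (Fin 2 → K) // IsSpecialLattice σ ϖ ((StdForm.antidiagonal 2).over K) M} |
      latticeTreeIso σ ϖ ((StdForm.antidiagonal 2).over K) tH v = v ∧ c v = 1}.Finite := Set.finite_of_ncard_ne_zero (by rw [hF1]; omega)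
  have hsplit : {v : {M : Submodule 𝒪[K] (Fin 2 → K) // IsSpecialLattice σ ϖ ((StdForm.antidiagonal 2).over K) M} |
      latticeTreeIso σ ϖ ((StdForm.antidiagonal 2).over K) tH v = v} =
      {v | latticeTreeIso σ ϖ ((StdForm.antidiagonal 2).over K) tH v = v ∧ c v = 0} ∪ {v | latticeTreeIso σ ϖ ((StdForm.antidiagonal 2).over K) tH v = v ∧ c v = 1} := by
    ext v
    simp only [Set.mem_setOf_eq, Set.mem_union]
    constructor
    · intro h
      rcases v.2 with hsd | hmd
      · exact Or.inl ⟨h, (hc0 v).2 hsd⟩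
      · exact Or.inr ⟨h, (hc1 v).2 hmd⟩
    · rintro (⟨h, -⟩ | ⟨h, -⟩) <;> exact h
  have hfin : {v : {M : Submodule 𝒪[K] (Fin 2 → K) // IsSpecialLattice σ ϖ ((StdForm.antidiagonal 2).over K) M} |
      latticeTreeIso σ ϖ ((StdForm.antidiagonal 2).over K) tH v = v}.Finite := by rw [hsplit]; exact hfin0.union hfin1
  have hF : {v : {M : Submodule 𝒪[K] (Fin 2 → K) // IsSpecialLattice σ ϖ ((StdForm.antidiagonal 2).over K) M} |
      latticeTreeIso σ ϖ ((StdForm.antidiagonal 2).over K) tH v = v}.ncard = P + P := by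
    rw [hsplit, Set.ncard_union_eq (Set.disjoint_left.2 fun v h0 h1 => absurd (h0.2.symm.trans h1.2) (by decide)) hfin0 hfin1, hF0, hF1]
  obtain ⟨u, hu, -⟩ : {v : {M : Submodule 𝒪[K] (Fin 2 → K) // IsSpecialLattice σ ϖ ((StdForm.antidiagonal 2).over K) M} |
      latticeTreeIso σ ϖ ((StdForm.antidiagonal 2).over K) tH v = v ∧ c v = 0}.Nonempty := Set.nonempty_of_ncard_ne_zero (by rw [hF0]; omega)
  -- the colour class `j ≠ i` of the fixed set has `P` elements
  obtain ⟨j, hij⟩ : ∃ j : Fin 2, i ≠ j := ⟨i + 1, by revert i; decide⟩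
  have hFj : (hfin.toFinset.filter (fun y => c y = j)).card = P := by
    have e : (hfin.toFinset.filter (fun y => c y = j) : Set _) = {v | latticeTreeIso σ ϖ ((StdForm.antidiagonal 2).over K) tH v = v ∧ c v = j} := by
      ext v; simp only [Finset.coe_filter, Set.Finite.mem_toFinset, Set.mem_setOf_eq]
    rw [← Set.ncard_coe_finset, e]
    fin_cases j
    · exact hF0
    · exact hF1
  -- valency as a `degree` statement at the fixed vertices
  have hdeg' : ∀ y, latticeTreeIso σ ϖ ((StdForm.antidiagonal 2).over K) tH y = y →
      (latticeTree σ ϖ ((StdForm.antidiagonal 2).over K)).degree y = (fun _ : Fin 2 => q + 1) (c y) := fun y _ => by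
    rw [← SimpleGraph.card_neighborFinset_eq_degree, ← hdeg y, SimpleGraph.neighborFinset_def, Set.ncard_eq_toFinset_card']
  have hFcard : hfin.toFinset.card = P + P := by rw [← Set.ncard_eq_toFinset_card _ hfin, hF]
  -- ★ GF1 FILE 1 bookkeeping and the arithmetic `(q − 1)·P + 1 = q^{N+1}`
  have hsum := ncard_displaced_two_inter_type_add_card_fixed_eq hT (latticeTreeIso σ ϖ ((StdForm.antidiagonal 2).over K) tH) hu hfin c hcadj hij
    (fun _ : Fin 2 => q + 1) hdeg'
  rw [hFj, hFcard] at hsum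
  have hq1 : 1 ≤ q := by
    rcases Nat.eq_zero_or_pos q with rfl | h
    · rw [zero_pow two_ne_zero] at hq; exact absurd hq (Nat.card_pos (α := IsLocalRing.ResidueField 𝒪[K])).ne'
    · exact h
  have hgeom : P * (q - 1) + 1 = q ^ (N + 1) := by
    have h := geom_sum_mul_add (q - 1) (N + 1)
    rwa [Nat.sub_add_cancel hq1, hP] at h
  -- `N_i + 2P = (q+1)·P + 1`, `P·(q−1) + 1 = q^{N+1}`
  zify [hq1, hP1] at hsum hgeom ⊢
  nlinarith [hsum, hgeom]

end Shells

end Summit.HodgeConjecture.HodgeConjecture.R90.S6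

end
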